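import Literature.AlgebraicGeometry.Resolution.GeneralizedStabilityRankOneVTProofs
import Mathlib.FieldTheory.IntermediateField.Adjoin.Algebra
import Mathlib.RingTheory.AlgebraicIndependent.Transcendental
import HarnessLib

/-!
# Kuhlmann 2010, Lemma 5.5 (Case I) from the italicized statement of §5 — proof

Topic: `Literature/AlgebraicGeometry/Resolution` (valued function fields). DISCHARGE, relative
to the named facts `Kuhlmann2010HenselizationIsHenselian` (§1.1 / Lemma 2.3),
`Kuhlmann2010HenselizationImmediate` (Lemma 2.2) (`Henselization.lean`) and
`Kuhlmann2010HenselizedRationalImmediateExt` (the italicized statement of §5, p. 19), of the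
named fact `Kuhlmann2010Lemma55ValueTranscendental` (`GeneralizedStabilityHenselizedRational.lean`)
= F.-V. Kuhlmann, *Elimination of ramification I: The generalized stability theorem*, Trans.
AMS 362 (2010) 5697–5727 = arXiv:1003.5678, Lemma 5.5 in Case I of its proof (with
Lemma 2.26), following the print (p. 19):

> *Proof.* Case I) Suppose `F` contains a value-transcendental element `x`. Since
> `K(x)‾ = K̄` is algebraically closed and `F̄|K(x)‾` is finite, we have `F̄ = K(x)‾`. Further,
> `vF` is a finite extension of `vK(x) = vK ⊕ ℤvx`. Since `vK` is divisible, we have that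
> `vF = vK ⊕ ℤα` for some `α ∈ vF`. Choose `x' ∈ F` such that `vx' = α`. Then
> `vF = vK ⊕ ℤvx' = vK(x')` by Lemma 2.5, and `F̄ = K̄ = K(x')‾`. Now the henselian field `F`
> contains the henselization `K(x')^h`, and we have just shown that `F|K(x')^h` is an
> immediate extension. But the henselized inertially generated function field `K(x')^h` of
> rank 1 and of transcendence degree 1 with value-transcendental generator `x'` over `K` does
> not admit any proper immediate algebraic extension. This yields `F = K(x')^h`.

## Content (everything PROVED)

* `IsValueTranscendentalOver.transcendental` — **Lemma 2.5**: a value-transcendental element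
  is transcendental (the terms `cᵢ xⁱ` of a relation have pairwise distinct values);
  `exists_valuation_eq_of_mem_adjoin`, `resField_adjoin_le` — **Lemma 2.5 for `K(x)`**:
  `vK(x) = vK·⟨vx⟩`, `K(x)‾ = K̄` (Knaf–Kuhlmann 2005, Thm. 2.1, `ValuationIndependence.lean`).
* `isAlgebraic_adjoin_swap` — the exchange property (`x'` transcendental over `K` and
  algebraic over `K(x)` ⇒ `x` algebraic over `K(x')`), from Mathlib's matroid of algebraic
  independence.
* `exists_valuation_eq_of_pow_eq_of_isAlgClosed_subfield` — `vK` is closed under roots inside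
  value groups for `K` algebraically closed (Lemma 2.1);
  `exists_valuation_pow_relRamificationIndex_eq` — `v(a)^e ∈ vM` for `e = (vN : vM)`;
  `exists_zpow_mul_zpow_pow_eq` — a Bézout step.
* `Kuhlmann2010Lemma55ValueTranscendental.of_immediateExt :
  Kuhlmann2010HenselizationIsHenselian → Kuhlmann2010HenselizationImmediate →
  Kuhlmann2010HenselizedRationalImmediateExt → Kuhlmann2010Lemma55ValueTranscendental` — the
  printed proof, with "`vF = vK ⊕ ℤα`" realised as follows: `F = F₁^h` is finite over
  `K(x)^h` (it is `K(x)^h(s)` for generators `s` of `F₁`, Lemma 2.3); among the exponents `n`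
  for which `v(x)` is an `n`-th power modulo `vK` in `vF` (bounded by `(vF : vK(x)^h)` through
  Lemma 2.2 and Lemma 2.5) take `n₀` maximal and `x'` with `v(x')^{n₀} ≡ v(x)`; a Bézout
  argument shows `vF ⊆ vK·⟨vx'⟩`; `F̄ = K̄` because residues of `F` are algebraic over
  `K(x)‾ = K̄`, which is algebraically closed; `F|K(x')^h` is algebraic by the exchange
  property; the italicized statement concludes.
* `Kuhlmann2010StabilityRankOneValueTranscendental.of_facts'` — **(R4) for `K(t)` of rank one
  with a value-transcendental generator over an algebraically closed `K`** from Thm. 2.14,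
  "the henselization is henselian", "the henselization is immediate", the Lemma of Ostrowski
  and the italicized statement of §5 (`…of_facts` of `GeneralizedStabilityRankOneVTProofs.lean`
  with Lemma 5.5 discharged).

## Sources

* F.-V. Kuhlmann, *Elimination of ramification I: The generalized stability theorem*, Trans.
  Amer. Math. Soc. 362 (2010) 5697–5727 = arXiv:1003.5678: Lemma 2.1, Lemma 2.2, Lemma 2.3,
  Lemma 2.5, §2.5 (Lemma 2.26), §5 (p. 19: the italicized statement; Lemma 5.5, Case I).
* H. Knaf, F.-V. Kuhlmann, *Abhyankar places admit local uniformization in any characteristic*,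
  Ann. Sci. ÉNS 38 (2005), Thm. 2.1 (`ValuationIndependence.lean`).

## Rendering notes

* After this file the trust base of `Kuhlmann2010StabilityRankOneValueTranscendental` is
  {`Kuhlmann2010DefectlessIffHenselization` (Thm. 2.14), `Kuhlmann2010HenselizationIsHenselian`,
  `Kuhlmann2010HenselizationImmediate` (Lemma 2.2), `Kuhlmann2010OstrowskiLemma` ((9)),
  `Kuhlmann2010HenselizedRationalImmediateExt` (p. 19)}.
-/

noncomputable section

open IsLocalRing

namespace Literature.AlgebraicGeometry.Resolution

universe u

section Helpers

variable {Ω : Type u} [Field Ω] {V : ValuationSubring Ω}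

omit V in
/-- `RelFinite` along an equality of the top field. [folklore] -/
theorem RelFinite.of_eq {M N N' : Subfield Ω} (h : M ≤ N) (hNN' : N = N') (hfin : RelFinite M N h) :
    RelFinite M N' (hNN' ▸ h) := by
  subst hNN'
  exact hfin

/-- Integer powers: `v(x)^m ∉ vK` for every `m ≠ 0` if `x` is value-transcendental over `K`.
[folklore] -/
theorem IsValueTranscendentalOver.zpow_ne {K : Subfield Ω} {x : Ω}
    (hx : IsValueTranscendentalOver V K x) {m : ℤ} (hm : m ≠ 0) {c : Ω} (hc : c ∈ K) :
    V.valuation x ^ m ≠ V.valuation c := by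
  intro h
  rcases Int.natAbs_eq m with hm' | hm'
  · rw [hm', zpow_natCast] at h
    exact hx m.natAbs (Int.natAbs_pos.mpr hm) c hc h
  · rw [hm', zpow_neg, zpow_natCast, inv_eq_iff_eq_inv, ← map_inv₀] at h
    exact hx m.natAbs (Int.natAbs_pos.mpr hm) c⁻¹ (K.inv_mem hc) h

/-- The values `v(c xⁱ)`, `c, d ∈ K^×`, are pairwise distinct for distinct exponents when `x`
is value-transcendental over `K`. [folklore] -/
theorem IsValueTranscendentalOver.eq_of_valuation_mul_pow_eq {K : Subfield Ω} {x : Ω}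
    (hx : IsValueTranscendentalOver V K x) {c d : Ω} (hc : c ∈ K) (hd : d ∈ K) (hc0 : c ≠ 0)
    (hd0 : d ≠ 0) {i j : ℕ} (h : V.valuation (c * x ^ i) = V.valuation (d * x ^ j)) : i = j := by
  by_contra hij
  have hx0 : V.valuation x ≠ 0 := (map_ne_zero _).mpr hx.ne_zero
  have hvc : V.valuation c ≠ 0 := (map_ne_zero _).mpr hc0
  have hvd : V.valuation d ≠ 0 := (map_ne_zero _).mpr hd0
  rw [map_mul, map_mul, map_pow, map_pow] at h
  -- `v(x)^(i - j) = v(d / c)` as integer powers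
  have key : V.valuation x ^ ((i : ℤ) - j) = V.valuation (d / c) := by
    rw [zpow_sub₀ hx0, zpow_natCast, zpow_natCast, map_div₀,
      div_eq_div_iff (pow_ne_zero _ hx0) hvc]
    calc V.valuation x ^ i * V.valuation c = V.valuation c * V.valuation x ^ i := mul_comm _ _
      _ = V.valuation d * V.valuation x ^ j := h
  exact hx.zpow_ne (by omega) (div_mem hd hc) key

/-- **A value-transcendental element is transcendental** (Kuhlmann 2010, Lemma 2.5: "In both
cases, `x` is transcendental over `K`"): a relation `∑ cᵢ xⁱ = 0` is impossible since the
non-zero terms have pairwise distinct values. PROVED. [cite: Kuhlmann2010, Lemma 2.5] -/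
theorem IsValueTranscendentalOver.transcendental {K : Subfield Ω} {x : Ω}
    (hx : IsValueTranscendentalOver V K x) : Transcendental K x := by
  classical
  rintro ⟨p, hp0, hpx⟩
  have hsupp : p.support.Nonempty := Polynomial.nonempty_support_iff.mpr hp0
  let a : ℕ → Ω := fun i => ((p.coeff i : K) : Ω) * x ^ i
  have hinj : Set.InjOn (fun i => V.valuation (a i)) p.support := by
    intro i hi j hj h
    have hi0 : ((p.coeff i : K) : Ω) ≠ 0 := by
      have := Polynomial.mem_support_iff.mp hi
      exact fun h0 => this (Subtype.ext h0)
    have hj0 : ((p.coeff j : K) : Ω) ≠ 0 := by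
      have := Polynomial.mem_support_iff.mp hj
      exact fun h0 => this (Subtype.ext h0)
    exact hx.eq_of_valuation_mul_pow_eq (p.coeff i).2 (p.coeff j).2 hi0 hj0 h
  obtain ⟨i₀, hi₀, hsum, -⟩ := exists_valuation_sum_eq V p.support hsupp a hinj
  have heval : ∑ i ∈ p.support, a i = 0 := by
    rw [Polynomial.aeval_def, Polynomial.eval₂_eq_sum, Polynomial.sum_def] at hpx
    exact hpx
  rw [heval, map_zero] at hsum
  have : a i₀ ≠ 0 := by
    have hc : ((p.coeff i₀ : K) : Ω) ≠ 0 := by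
      have := Polynomial.mem_support_iff.mp hi₀
      exact fun h0 => this (Subtype.ext h0)
    exact mul_ne_zero hc (pow_ne_zero _ hx.ne_zero)
  exact this ((map_eq_zero V.valuation).mp hsum.symm)

/-- **Root extraction in `vK` for `K` algebraically closed**: if `v(y)^g = v(c)` with `g ≠ 0`
and `c ∈ K`, then `v(y) = v(c')` for a `g`-th root `c' ∈ K` of `c` (`vK` is divisible and value
groups are torsion free). [cite: Kuhlmann2010, Lemma 2.1] -/
theorem exists_valuation_eq_of_pow_eq_of_isAlgClosed_subfield {K : Subfield Ω}
    (hK : IsAlgClosed K) {y c : Ω} (hc : c ∈ K) {g : ℕ} (hg : g ≠ 0)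
    (h : V.valuation y ^ g = V.valuation c) :
    ∃ c' ∈ K, V.valuation y = V.valuation c' := by
  obtain ⟨z, hz⟩ := IsAlgClosed.exists_pow_nat_eq (⟨c, hc⟩ : K) (Nat.pos_of_ne_zero hg)
  refine ⟨z, z.2, valuation_eq_of_pow_eq V hg ?_⟩
  rw [h, ← map_pow]
  congr 1
  exact (congrArg Subtype.val hz).symm

/-- **The exchange property for one element** (Steinitz): if `x'` is transcendental over `K`
and algebraic over `K(x)`, then `x` is algebraic over `K(x')`. PROVED from Mathlib's matroid of
algebraic independence (`AlgebraicIndependent.option_iff`). [folklore] -/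
theorem isAlgebraic_adjoin_swap {K : Subfield Ω} {x x' : Ω} (hx' : Transcendental K x')
    (halg : IsAlgebraic (IntermediateField.adjoin K ({x} : Set Ω)) x') :
    IsAlgebraic (IntermediateField.adjoin K ({x'} : Set Ω)) x := by
  classical
  open scoped IntermediateField.algebraAdjoinAdjoin in
  by_contra h
  -- transcendence over `K[x']` (algebraicity over `K[x']` would give it over `K(x')`)
  have h1 : Transcendental (Algebra.adjoin K (Set.range fun _ : Unit => x')) x := by
    rw [Set.range_const]
    intro halg'
    exact h ((IsFractionRing.isAlgebraic_iff _ (IntermediateField.adjoin K ({x'} : Set Ω)) Ω).mp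
      halg')
  have hind : AlgebraicIndependent K (fun _ : Unit => x') :=
    algebraicIndependent_unique_type_iff.mpr hx'
  have h2 : AlgebraicIndependent K (fun o : Option Unit => o.elim x fun _ : Unit => x') :=
    AlgebraicIndependent.option_iff.mpr ⟨hind, h1⟩
  -- swap the two elements
  have h3 : AlgebraicIndependent K (fun o : Option Unit => o.elim x' fun _ : Unit => x) := by
    have := h2.comp _ (Equiv.swap (none : Option Unit) (some ())).injective
    convert this using 1
    funext o
    rcases o with _ | ⟨⟨⟩⟩
    · simp [Equiv.swap_apply_left]
    · simp [Equiv.swap_apply_right]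
  have h4 : Transcendental (Algebra.adjoin K (Set.range fun _ : Unit => x)) x' :=
    (AlgebraicIndependent.option_iff.mp h3).2
  rw [Set.range_const] at h4
  exact h4 ((IsFractionRing.isAlgebraic_iff _ (IntermediateField.adjoin K ({x} : Set Ω)) Ω).mpr
    halg)

/-- **Kuhlmann 2010, Lemma 2.5, values of `K(x)`** (`vK(x) = vK ⊕ ℤvx`): every non-zero element
of `K(x)`, `x` value-transcendental over `K`, has value `v(c) v(x)^m` with `c ∈ K`, `m ∈ ℤ`.
PROVED (Knaf–Kuhlmann 2005, Thm. 2.1, `exists_valuation_eq_of_mem_closure`).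
[cite: Kuhlmann2010, Lemma 2.5] -/
theorem exists_valuation_eq_of_mem_adjoin {K : Subfield Ω} {x : Ω}
    (hx : IsValueTranscendentalOver V K x) {a : Ω}
    (ha : a ∈ (IntermediateField.adjoin K ({x} : Set Ω)).toSubfield) (ha0 : a ≠ 0) :
    ∃ c ∈ K, ∃ m : ℤ, V.valuation a = V.valuation c * V.valuation x ^ m := by
  have hxi : ∀ m : Unit → ℤ,
      (∃ b ∈ K, (∏ i, V.valuation ((fun _ : Unit => x) i) ^ (m i)) = V.valuation b) → m = 0 := by
    rintro m ⟨b, hb, hmb⟩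
    funext i
    simp only [Finset.univ_unique, Finset.prod_singleton] at hmb
    by_contra hmi
    exact hx.zpow_ne hmi hb (by rw [show i = default from Subsingleton.elim _ _]; exact hmb)
  have hy : ∀ j : Empty, (Empty.elim j : Ω) ∈ V := fun j => j.elim
  have hri : AlgebraicIndependent (resField V K) (fun j : Empty => residue V ⟨Empty.elim j, hy j⟩) :=
    algebraicIndependent_empty_type_iff.mpr (algebraMap (resField V K) (ResidueField V)).injective
  have ha' : a ∈ Subfield.closure ((K : Set Ω) ∪
      (Set.range (fun _ : Unit => x) ∪ Set.range (fun j : Empty => (Empty.elim j : Ω)))) := by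
    rw [Set.range_const, Set.range_eq_empty, Set.union_empty, ← adjoin_toSubfield_eq_closure]
    exact ha
  obtain ⟨m, b, hb, hab⟩ := exists_valuation_eq_of_mem_closure V K (fun _ => hx.ne_zero) hxi hy hri ha' ha0
  refine ⟨b, hb, m (), ?_⟩
  simpa using hab

/-- **Kuhlmann 2010, Lemma 2.5, residues of `K(x)`** (`K(x)v = Kv`): residues of elements of
`V ∩ K(x)`, `x` value-transcendental over `K`, lie in the residue field of `K`. PROVED
(Knaf–Kuhlmann 2005, Thm. 2.1, `residue_mem_closure_of_mem_closure`).
[cite: Kuhlmann2010, Lemma 2.5] -/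
theorem resField_adjoin_le {K : Subfield Ω} {x : Ω} (hx : IsValueTranscendentalOver V K x) :
    resField V (IntermediateField.adjoin K ({x} : Set Ω)).toSubfield ≤ resField V K := by
  intro r hr
  obtain ⟨a, ha, rfl⟩ := (mem_resField_iff V _ r).mp hr
  have hxi : ∀ m : Unit → ℤ,
      (∃ b ∈ K, (∏ i, V.valuation ((fun _ : Unit => x) i) ^ (m i)) = V.valuation b) → m = 0 := by
    rintro m ⟨b, hb, hmb⟩
    funext i
    simp only [Finset.univ_unique, Finset.prod_singleton] at hmb
    by_contra hmi
    exact hx.zpow_ne hmi hb (by rw [show i = default from Subsingleton.elim _ _]; exact hmb)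
  have hy : ∀ j : Empty, (Empty.elim j : Ω) ∈ V := fun j => j.elim
  have hri : AlgebraicIndependent (resField V K) (fun j : Empty => residue V ⟨Empty.elim j, hy j⟩) :=
    algebraicIndependent_empty_type_iff.mpr (algebraMap (resField V K) (ResidueField V)).injective
  have ha' : (a : Ω) ∈ Subfield.closure ((K : Set Ω) ∪
      (Set.range (fun _ : Unit => x) ∪ Set.range (fun j : Empty => (Empty.elim j : Ω)))) := by
    rw [Set.range_const, Set.range_eq_empty, Set.union_empty, ← adjoin_toSubfield_eq_closure]
    exact ha
  have := residue_mem_closure_of_mem_closure V K (fun _ => hx.ne_zero) hxi hy hri ha' a.2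
  rw [Set.range_eq_empty, Set.union_empty, Subfield.closure_eq] at this
  exact this

/-- **`v(a)^e ∈ vM` for `e = (vN : vM)`**: for an extension `M ≤ N` of subfields and
`a ∈ N^×`, `v(a)^{e(N|M)}` is the value of a non-zero element of `M` (Lagrange in `vN/vM`;
trivially true with `e = 0` for an infinite index). [folklore] -/
theorem exists_valuation_pow_relRamificationIndex_eq {M N : Subfield Ω} (h : M ≤ N)
    {a : Ω} (ha : a ∈ N) (ha0 : a ≠ 0) :
    ∃ b ∈ M, b ≠ 0 ∧ V.valuation a ^ relRamificationIndex V M N h = V.valuation b := by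
  letI : Algebra M N := (Subfield.inclusion h).toAlgebra
  have hWa : (V.comap (algebraMap N Ω)).valuation ⟨a, ha⟩ ≠ 0 :=
    (Valuation.ne_zero_iff _).mpr fun h0 => ha0 (congrArg Subtype.val h0)
  have hmem := Subgroup.pow_index_mem (valueSubgroup M (V.comap (algebraMap N Ω))) (Units.mk0 _ hWa)
  obtain ⟨c, hc0, hc⟩ := (mem_valueSubgroup_iff M (V.comap (algebraMap N Ω)) _).mp hmem
  refine ⟨c, c.2, fun h0 => hc0 (Subtype.ext h0), ?_⟩
  have := congrArg (valueGroupHom N V) hc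
  rw [Units.val_pow_eq_pow_val, Units.val_mk0, map_pow, valueGroupHom_valuation,
    valueGroupHom_valuation] at this
  exact this

end Helpers

/-! ### A Bézout step in a commutative group with zero -/

section Bezout

/-- In a commutative group with zero: if `B^{n'} = C · X^{M'}` with `n', M'` coprime, then
`(X^u B^w)^{n'} = C^w · X` for a Bézout pair `u n' + w M' = 1`. [folklore] -/
theorem exists_zpow_mul_zpow_pow_eq {G : Type*} [CommGroupWithZero G] {X B C : G} (hX : X ≠ 0)
    {n' M' : ℤ} (hcop : IsCoprime n' M') (h : B ^ n' = C * X ^ M') :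
    ∃ u w : ℤ, (X ^ u * B ^ w) ^ n' = C ^ w * X := by
  obtain ⟨u, w, huw⟩ := hcop
  refine ⟨u, w, ?_⟩
  calc (X ^ u * B ^ w) ^ n' = X ^ (u * n') * (B ^ n') ^ w := by
        rw [mul_zpow, ← zpow_mul, ← zpow_mul, ← zpow_mul, mul_comm w n']
    _ = X ^ (u * n') * (C ^ w * X ^ (M' * w)) := by rw [h, mul_zpow, ← zpow_mul]
    _ = C ^ w * X ^ (u * n' + w * M') := by rw [zpow_add₀ hX, mul_comm w M', mul_left_comm]
    _ = C ^ w * X := by rw [huw, zpow_one]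

end Bezout

/-! ### Lemma 5.5 (Case I) from the italicized statement of §5 -/

section Lemma55

/-- Algebraicity over an intermediate field `S` and over the subfield `S.toSubfield` agree.
[folklore] -/
theorem isAlgebraic_toSubfield_of_isAlgebraic {Ω : Type u} [Field Ω] {K : Subfield Ω}
    {S : IntermediateField K Ω} {a : Ω} (h : IsAlgebraic S a) : IsAlgebraic S.toSubfield a :=
  isAlgebraic_of_ringHom_comp_eq (F₁ := S) (F₂ := S.toSubfield)
    { toFun := fun z => ⟨z.1, z.2⟩
      map_one' := rfl
      map_mul' := fun _ _ => rfl
      map_zero' := rfl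
      map_add' := fun _ _ => rfl } (RingHom.ext fun _ => rfl) h

/-- **Kuhlmann 2010, Lemma 5.5 (Case I), PROVED from the italicized statement of §5** (with
Lemma 2.2 "the henselization is immediate" and "the henselization is henselian"), following the
printed proof: for `F = F₁^h` with `F₁ = K(x, s)` finite over `K(x)`, `x` value-transcendental
over the algebraically closed `K`, and `F` of rank one —
"`vF` is a finite extension of `vK(x) = vK ⊕ ℤvx`. Since `vK` is divisible, we have that
`vF = vK ⊕ ℤα` for some `α ∈ vF`. Choose `x' ∈ F` such that `vx' = α`. Then
`vF = vK ⊕ ℤvx' = vK(x')` by Lemma 2.5, and `F̄ = K̄ = K(x')‾`. Now the henselian field `F`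
contains the henselization `K(x')^h`, and we have just shown that `F|K(x')^h` is an immediate
extension. But … `K(x')^h` … does not admit any proper immediate algebraic extension. This
yields `F = K(x')^h`." Here `α` is produced as the value of an `x' ∈ F` for which `v(x)` is an
`n₀`-th power of `v(x')` modulo `vK` with `n₀` MAXIMAL (bounded by `(vF : vK(x)^h)`); a Bézout
argument shows `vF ⊆ vK·⟨vx'⟩`; `F̄ = K̄` because `F̄` is algebraic over `K(x)‾ = K̄`
(Lemma 2.5), which is algebraically closed; `F|K(x')^h` is algebraic by the exchange property
(`x'` is transcendental over `K`, Lemma 2.5, and algebraic over `K(x)`).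
[cite: Kuhlmann2010, Lemma 5.5 and Lemma 2.26] -/
theorem Kuhlmann2010Lemma55ValueTranscendental.of_immediateExt
    (hH : Kuhlmann2010HenselizationIsHenselian.{u})
    (hI : Kuhlmann2010HenselizationImmediate.{u})
    (hM : Kuhlmann2010HenselizedRationalImmediateExt.{u}) :
    Kuhlmann2010Lemma55ValueTranscendental.{u} := by
  intro Ω _ _ V K F₁ hK hKF₁ hFG x hxF₁ hx halg hr
  classical
  set Kx : Subfield Ω := (IntermediateField.adjoin K ({x} : Set Ω)).toSubfield with hKxdef
  set F' : Subfield Ω := henselizedAdjoin V K x with hF'def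
  set E : Subfield Ω := henselization V F₁ with hEdef
  have hKKx : K ≤ Kx := fun c hc => (IntermediateField.adjoin K ({x} : Set Ω)).algebraMap_mem ⟨c, hc⟩
  have hxKx : x ∈ Kx := IntermediateField.subset_adjoin K ({x} : Set Ω) (Set.mem_singleton x)
  have hKxF₁ : Kx ≤ F₁ := by
    rw [hKxdef, adjoin_toSubfield_eq_closure]
    exact Subfield.closure_le.mpr (Set.union_subset hKF₁ (Set.singleton_subset_iff.mpr hxF₁))
  have hKxF' : Kx ≤ F' := adjoin_le_henselizedAdjoin V K x
  have hF'E : F' ≤ E := henselization_mono V hH hKxF₁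
  have hF₁E : F₁ ≤ E := le_henselization V F₁
  have hKE : K ≤ E := hKF₁.trans hF₁E
  have hxE : x ∈ E := hF₁E hxF₁
  have hEhens : IsHenselianField E (V.comap (algebraMap E Ω)) := hH Ω V F₁
  have hx0 : V.valuation x ≠ 0 := (map_ne_zero _).mpr hx.ne_zero
  -- algebraicity over `Kx` in subfield form
  have halgKx : ∀ a ∈ F₁, IsAlgebraic Kx a := fun a ha =>
    isAlgebraic_toSubfield_of_isAlgebraic (halg a ha)
  ---------------------------------------------------------------- Step 1: `E|F'` is finite
  obtain ⟨s₁, hs₁⟩ := hFG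
  have hs₁F₁ : (↑s₁ : Set Ω) ⊆ F₁ := fun y hy => hs₁ ▸ Subfield.subset_closure (Or.inr hy)
  let N₀ : IntermediateField F' Ω := IntermediateField.adjoin F' (↑s₁ : Set Ω)
  have hs₁int : ∀ y ∈ (↑s₁ : Set Ω), IsIntegral F' y := fun y hy =>
    (isAlgebraic_of_subfield_le hKxF' (halgKx y (hs₁F₁ hy))).isIntegral
  haveI : FiniteDimensional F' N₀ := IntermediateField.finiteDimensional_adjoin hs₁int
  have hF'N₀ : F' ≤ N₀.toSubfield := le_toSubfield_of_intermediateField N₀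
  have hF₁N₀ : F₁ ≤ N₀.toSubfield := by
    rw [← hs₁]
    refine Subfield.closure_le.mpr (Set.union_subset (fun c hc => hF'N₀ (hKxF' (hKKx hc))) ?_)
    exact fun y hy => IntermediateField.subset_adjoin F' _ hy
  have hN₀alg : ∀ a ∈ N₀.toSubfield, IsAlgebraic F' a := fun a ha => by
    haveI := IntermediateField.isAlgebraic_adjoin hs₁int
    exact IntermediateField.isAlgebraic_iff.mp (Algebra.IsAlgebraic.isAlgebraic (⟨a, ha⟩ : N₀))
  have hN₀hens : IsHenselianField N₀.toSubfield (V.comap (algebraMap N₀.toSubfield Ω)) :=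
    isHenselianField_of_henselizedAdjoin_le hH hF'N₀ hN₀alg
  have hEN₀ : E ≤ N₀.toSubfield := henselization_le_of_isHenselianField V F₁ hF₁N₀ hN₀hens
  have hN₀E : N₀.toSubfield ≤ E := by
    have : N₀ ≤ E.toIntermediateField fun c => hF'E c.2 :=
      IntermediateField.adjoin_le_iff.mpr fun y hy => hF₁E (hs₁F₁ hy)
    exact fun y hy => this hy
  have hEeq : E = N₀.toSubfield := le_antisymm hEN₀ hN₀E
  have hfin : RelFinite F' E hF'E := RelFinite.of_eq _ hEeq.symm (relFinite_toSubfield N₀)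
  ---------------------------------------------------------------- Step 2: values of `E`
  have halgE : ∀ a ∈ E, IsAlgebraic Kx a := fun a ha =>
    isAlgebraic_toSubfield_of_isAlgebraic (isAlgebraic_adjoin_of_relFinite hF'E hfin ha)
  have hvalE : ∀ a ∈ E, a ≠ 0 → ∃ n : ℕ, 0 < n ∧ ∃ c ∈ K, c ≠ 0 ∧ ∃ m : ℤ,
      V.valuation a ^ n = V.valuation c * V.valuation x ^ m := by
    intro a ha ha0
    obtain ⟨n, hn, b, hb, hab⟩ := exists_valuation_pow_eq_of_isAlgebraic V (halgE a ha) ha0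
    have hb0 : b ≠ 0 := by
      rintro rfl
      rw [map_zero, map_pow, pow_eq_zero_iff hn, map_eq_zero] at hab
      exact ha0 hab
    obtain ⟨c, hc, m, hbc⟩ := exists_valuation_eq_of_mem_adjoin hx hb hb0
    have hc0 : c ≠ 0 := by
      rintro rfl
      rw [map_zero, zero_mul, map_eq_zero] at hbc
      exact hb0 hbc
    exact ⟨n, Nat.pos_of_ne_zero hn, c, hc, hc0, m, by rw [← map_pow, hab, hbc]⟩
  ---------------------------------------------------------------- Step 3: the maximal exponent
  let P : ℕ → Prop := fun n => 0 < n ∧ ∃ a ∈ E, a ≠ 0 ∧ ∃ c ∈ K, c ≠ 0 ∧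
    V.valuation a ^ n = V.valuation c * V.valuation x
  have hP1 : P 1 := ⟨one_pos, x, hxE, hx.ne_zero, 1, K.one_mem, one_ne_zero,
    by rw [pow_one, map_one, one_mul]⟩
  have he1 : 1 ≤ relRamificationIndex V F' E hF'E :=
    (one_le_relRamificationIndex_and_relInertiaDegree hF'E hfin).1
  have hPbound : ∀ n, P n → n ≤ relRamificationIndex V F' E hF'E := by
    rintro n ⟨hn, a, ha, ha0, c, hc, hc0, hac⟩
    set e := relRamificationIndex V F' E hF'E with hedef
    obtain ⟨b₁, hb₁, hb₁0, hab₁⟩ := exists_valuation_pow_relRamificationIndex_eq hF'E ha ha0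
    obtain ⟨b₂, hb₂, hb₁₂⟩ := (hI Ω V Kx).1 b₁ hb₁ hb₁0
    have hb₂0 : b₂ ≠ 0 := by
      rintro rfl
      rw [map_zero, map_eq_zero] at hb₁₂
      exact hb₁0 hb₁₂
    obtain ⟨c', hc', k, hb₂c⟩ := exists_valuation_eq_of_mem_adjoin hx hb₂ hb₂0
    have hvc : V.valuation c ≠ 0 := (map_ne_zero _).mpr hc0
    have hvc' : V.valuation c' ≠ 0 := by
      rintro h0
      rw [h0, zero_mul, map_eq_zero] at hb₂c
      exact hb₂0 hb₂c
    -- `v(a)^(n e)` computed in two ways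
    have h1 : V.valuation a ^ (n * e) = V.valuation c ^ e * V.valuation x ^ (e : ℤ) := by
      rw [pow_mul, hac, mul_pow, zpow_natCast]
    have h2 : V.valuation a ^ (n * e) = V.valuation c' ^ n * V.valuation x ^ (k * n) := by
      rw [mul_comm n e, pow_mul, hab₁, hb₁₂, hb₂c, mul_pow, ← zpow_natCast (V.valuation x ^ k) n,
        ← zpow_mul]
    by_cases heq : (e : ℤ) = k * n
    · have hdvd : (n : ℤ) ∣ (e : ℤ) := ⟨k, by rw [heq, mul_comm]⟩
      exact Nat.le_of_dvd (by omega) (Int.natCast_dvd_natCast.mp hdvd)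
    · exfalso
      have key : V.valuation x ^ ((e : ℤ) - k * n) = V.valuation (c' ^ n / c ^ e) := by
        rw [zpow_sub₀ hx0, map_div₀, map_pow, map_pow,
          div_eq_div_iff (zpow_ne_zero _ hx0) (pow_ne_zero _ hvc)]
        calc V.valuation x ^ (e : ℤ) * V.valuation c ^ e
            = V.valuation c ^ e * V.valuation x ^ (e : ℤ) := mul_comm _ _
          _ = V.valuation a ^ (n * e) := h1.symm
          _ = V.valuation c' ^ n * V.valuation x ^ (k * n) := h2
      exact hx.zpow_ne (sub_ne_zero.mpr heq) (div_mem (pow_mem hc' n) (pow_mem hc e)) key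
  obtain ⟨hn₀pos, x', hx'E, hx'0, c₀, hc₀, hc₀0, hstar⟩ :
      P (Nat.findGreatest P (relRamificationIndex V F' E hF'E)) := Nat.findGreatest_spec he1 hP1
  set n₀ := Nat.findGreatest P (relRamificationIndex V F' E hF'E) with hn₀def
  have hmax : ∀ n, P n → n ≤ n₀ := fun n hn => Nat.le_findGreatest (hPbound n hn) hn
  have hX'0 : V.valuation x' ≠ 0 := (map_ne_zero _).mpr hx'0
  have hvc₀ : V.valuation c₀ ≠ 0 := (map_ne_zero _).mpr hc₀0
  ---------------------------------------------------------------- Step 4: `x'` is value-transcendental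
  have hx' : IsValueTranscendentalOver V K x' := by
    intro n hn c hc h
    have hvc : V.valuation c ≠ 0 := by rw [← h]; exact pow_ne_zero _ hX'0
    apply hx n hn (c ^ n₀ / c₀ ^ n) (div_mem (pow_mem hc _) (pow_mem hc₀ _))
    have : (V.valuation c₀ * V.valuation x) ^ n = V.valuation c ^ n₀ := by
      rw [← hstar, ← pow_mul, mul_comm n₀ n, pow_mul, h]
    rw [map_div₀, map_pow, map_pow, eq_div_iff (pow_ne_zero _ hvc₀), ← this, mul_pow, mul_comm]
  ---------------------------------------------------------------- Step 5: `vE ⊆ vK·⟨v x'⟩`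
  have hvalx' : ∀ b ∈ E, b ≠ 0 → ∃ c ∈ K, ∃ M : ℤ,
      V.valuation b = V.valuation c * V.valuation x' ^ M := by
    intro b hb hb0
    have hvb : V.valuation b ≠ 0 := (map_ne_zero _).mpr hb0
    obtain ⟨n, hn, c₁, hc₁, hc₁0, m, hbn⟩ := hvalE b hb hb0
    have hvc₁ : V.valuation c₁ ≠ 0 := (map_ne_zero _).mpr hc₁0
    -- `v(x) = v(x')^{n₀} v(c₀)⁻¹`, so `v(b)^n = v(c₂) v(x')^{m n₀}` with `c₂ = c₁ c₀^{-m}`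
    have hvx : V.valuation x = V.valuation x' ^ (n₀ : ℤ) * (V.valuation c₀)⁻¹ := by
      rw [zpow_natCast, hstar, mul_comm (V.valuation c₀), mul_inv_cancel_right₀ hvc₀]
    have hc₂ : c₁ * c₀ ^ (-m) ∈ K := mul_mem hc₁ (zpow_mem hc₀ _)
    have hc₂0 : c₁ * c₀ ^ (-m) ≠ 0 := mul_ne_zero hc₁0 (zpow_ne_zero _ hc₀0)
    have hbn' : V.valuation b ^ (n : ℤ) = V.valuation (c₁ * c₀ ^ (-m)) * V.valuation x' ^ ((n₀ : ℤ) * m) := by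
      rw [zpow_natCast, hbn, hvx, mul_zpow, ← zpow_mul, inv_zpow', map_mul, map_zpow₀]
      ac_rfl
    -- divide the exponents by their gcd
    have hgpos : 0 < Int.gcd (n : ℤ) ((n₀ : ℤ) * m) :=
      Int.gcd_pos_of_ne_zero_left _ (by exact_mod_cast hn.ne')
    obtain ⟨g, n', M', hg, hcop, hn', hM'⟩ := Int.exists_gcd_one' hgpos
    have hcop' : IsCoprime n' M' := Int.isCoprime_iff_gcd_eq_one.mpr hcop
    have hn'pos : 0 < n' := by
      have h0 : (0 : ℤ) < n' * g := by rw [← hn']; exact_mod_cast hn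
      nlinarith [h0, hg]
    -- `(v(b)^{n'} v(x')^{-M'})^g = v(c₂)`
    have key1 : V.valuation (b ^ n' * x' ^ (-M')) ^ g = V.valuation (c₁ * c₀ ^ (-m)) := by
      rw [map_mul, map_zpow₀, map_zpow₀, mul_pow, ← zpow_natCast (V.valuation b ^ n') g,
        ← zpow_natCast (V.valuation x' ^ (-M')) g, ← zpow_mul, ← zpow_mul, ← hn', neg_mul, ← hM',
        hbn', mul_assoc, ← zpow_add₀ hX'0, add_neg_cancel, zpow_zero, mul_one]
    obtain ⟨c₃, hc₃, hc₃eq⟩ :=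
      exists_valuation_eq_of_pow_eq_of_isAlgClosed_subfield hK hc₂ (Nat.pos_iff_ne_zero.mp hg) key1
    have hc₃0 : c₃ ≠ 0 := by
      rintro rfl
      rw [map_zero, map_eq_zero] at hc₃eq
      exact mul_ne_zero (zpow_ne_zero _ hb0) (zpow_ne_zero _ hx'0) hc₃eq
    have hvc₃ : V.valuation c₃ ≠ 0 := (map_ne_zero _).mpr hc₃0
    -- `v(b)^{n'} = v(c₃) v(x')^{M'}`
    have h2 : V.valuation b ^ n' = V.valuation c₃ * V.valuation x' ^ M' := by
      rw [map_mul, map_zpow₀, map_zpow₀, zpow_neg, mul_inv_eq_iff_eq_mul₀ (zpow_ne_zero _ hX'0)]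
        at hc₃eq
      exact hc₃eq
    -- Bézout: `z = x'^u b^w` has `v(z)^{n'} = v(c₃)^w v(x')`, so `n' n₀` is an admissible exponent
    obtain ⟨u, w, hz⟩ := exists_zpow_mul_zpow_pow_eq hX'0 hcop' h2
    have hzval : V.valuation (x' ^ u * b ^ w) ^ n' = V.valuation c₃ ^ w * V.valuation x' := by
      rw [map_mul, map_zpow₀, map_zpow₀]; exact hz
    have hPbig : P (n'.toNat * n₀) := by
      refine ⟨Nat.mul_pos (by omega) hn₀pos, x' ^ u * b ^ w,
        mul_mem (zpow_mem hx'E u) (zpow_mem hb w),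
        mul_ne_zero (zpow_ne_zero _ hx'0) (zpow_ne_zero _ hb0), c₃ ^ (w * n₀) * c₀,
        mul_mem (zpow_mem hc₃ _) hc₀, mul_ne_zero (zpow_ne_zero _ hc₃0) hc₀0, ?_⟩
      rw [pow_mul, ← zpow_natCast (V.valuation (x' ^ u * b ^ w)) n'.toNat,
        Int.toNat_of_nonneg hn'pos.le, hzval, mul_pow, hstar, map_mul, map_zpow₀,
        ← zpow_natCast (V.valuation c₃ ^ w) n₀, ← zpow_mul, mul_assoc]
    have hle : n'.toNat * n₀ ≤ n₀ := hmax _ hPbig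
    have hn'1 : n' = 1 := by
      have h1 : n'.toNat * n₀ ≤ 1 * n₀ := by rwa [one_mul]
      have h3 : n'.toNat ≤ 1 := Nat.le_of_mul_le_mul_right h1 hn₀pos
      omega
    rw [hn'1, zpow_one] at h2
    exact ⟨c₃, hc₃, M', h2⟩
  ---------------------------------------------------------------- Step 6: residues `Ev = Kv`
  haveI : IsAlgClosed K := hK
  have hres : resField V E ≤ resField V K := by
    intro r hr
    obtain ⟨a, haE, rfl⟩ := (mem_resField_iff V E r).mp hr
    obtain ⟨p, hp0, hpa⟩ := halgE a haE
    have hP0 : p.map (algebraMap Kx Ω) ≠ 0 :=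
      (Polynomial.map_ne_zero_iff (algebraMap Kx Ω).injective).mpr hp0
    have hPc : ∀ k, (p.map (algebraMap Kx Ω)).coeff k ∈ Kx := fun k => by
      rw [Polynomial.coeff_map]; exact (p.coeff k).2
    have hPa : (p.map (algebraMap Kx Ω)).eval (a : Ω) = 0 := by
      rw [Polynomial.eval_map, ← Polynomial.aeval_def]; exact hpa
    have h1 : IsAlgebraic (resField V Kx) (residue V ⟨(a : Ω), a.2⟩) :=
      isAlgebraic_residue_of_eval_eq_zero V Kx hP0 hPc a.2 hPa
    have h2 : IsAlgebraic (resField V K) (residue V a) :=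
      isAlgebraic_of_subfield_le (resField_adjoin_le hx) h1
    haveI : IsAlgClosed (resField V K) := isAlgClosed_resField_of_isAlgClosed V K
    have hdeg := IsAlgClosed.degree_eq_one_of_irreducible (resField V K)
      (minpoly.irreducible h2.isIntegral)
    obtain ⟨r', hr'⟩ := minpoly.mem_range_of_degree_eq_one (resField V K) _ hdeg
    rw [← hr']
    exact r'.2
  ---------------------------------------------------------------- Step 7: `K(x')^h ≤ E`, algebraic, immediate
  set Kx' : Subfield Ω := (IntermediateField.adjoin K ({x'} : Set Ω)).toSubfield with hKx'def
  have hKKx' : K ≤ Kx' := fun c hc =>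
    (IntermediateField.adjoin K ({x'} : Set Ω)).algebraMap_mem ⟨c, hc⟩
  have hKx'E : Kx' ≤ E := by
    rw [hKx'def, adjoin_toSubfield_eq_closure]
    exact Subfield.closure_le.mpr (Set.union_subset hKE (Set.singleton_subset_iff.mpr hx'E))
  have hF''E : henselizedAdjoin V K x' ≤ E :=
    henselization_le_of_isHenselianField V Kx' hKx'E hEhens
  have hKF'' : K ≤ henselizedAdjoin V K x' := le_henselizedAdjoin V K x'
  -- `x` is algebraic over `K(x')` (exchange), hence `E` is algebraic over `K(x')^h`
  have hx'alg : IsAlgebraic (IntermediateField.adjoin K ({x} : Set Ω)) x' :=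
    isAlgebraic_adjoin_of_relFinite hF'E hfin hx'E
  have hxalg' : IsAlgebraic (IntermediateField.adjoin K ({x'} : Set Ω)) x :=
    isAlgebraic_adjoin_swap hx'.transcendental hx'alg
  have halgF'' : ∀ b ∈ E, IsAlgebraic (henselizedAdjoin V K x') b := by
    intro b hb
    -- over the subfield `K(x')(x) ⊇ K(x)`, `b` is algebraic; and `K(x')(x)` is algebraic over `K(x')`
    let F : Subfield Ω := Subfield.closure ((Kx' : Set Ω) ∪ {x})
    have hKxF : Kx ≤ F := by
      rw [hKxdef, adjoin_toSubfield_eq_closure]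
      refine Subfield.closure_le.mpr (Set.union_subset ?_ ?_)
      · exact fun c hc => Subfield.subset_closure (Or.inl (hKKx' hc))
      · exact Set.singleton_subset_iff.mpr (Subfield.subset_closure (Or.inr rfl))
    have hbF : IsAlgebraic F b := isAlgebraic_of_subfield_le hKxF (halgE b hb)
    have hFalg : ∀ w ∈ F, IsAlgebraic (IntermediateField.adjoin K ({x'} : Set Ω)) w := by
      intro w hw
      have hw' : IsAlgebraic Kx' w :=
        isAlgebraic_of_mem_closure (K := Kx') (s := {x})
          (fun y hy => by
            rw [Set.mem_singleton_iff.mp hy]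
            exact isAlgebraic_toSubfield_of_isAlgebraic hxalg') hw
      exact isAlgebraic_of_ringHom_comp_eq (F₁ := Kx')
        (F₂ := IntermediateField.adjoin K ({x'} : Set Ω))
        { toFun := fun z => ⟨z.1, z.2⟩
          map_one' := rfl
          map_mul' := fun _ _ => rfl
          map_zero' := rfl
          map_add' := fun _ _ => rfl } (RingHom.ext fun _ => rfl) hw'
    have hKF : K ≤ F := fun c hc => Subfield.subset_closure (Or.inl (hKKx' hc))
    have hx'F : ({x'} : Set Ω) ⊆ F := Set.singleton_subset_iff.mpr
      (Subfield.subset_closure (Or.inl (IntermediateField.subset_adjoin K _ (Set.mem_singleton x'))))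
    have h1 : IsAlgebraic (IntermediateField.adjoin K ({x'} : Set Ω)) b :=
      isAlgebraic_adjoin_of_isAlgebraic_subfield hKF hx'F hFalg hbF
    exact isAlgebraic_of_subfield_le (adjoin_le_henselizedAdjoin V K x')
      (isAlgebraic_toSubfield_of_isAlgebraic h1)
  have himm : IsImmediateOver V (henselizedAdjoin V K x') E := by
    refine ⟨fun b hb hb0 => ?_, hres.trans (resField_mono V hKF'')⟩
    obtain ⟨c, hc, M, h⟩ := hvalx' b hb hb0
    refine ⟨c * x' ^ M, mul_mem (hKF'' hc) (zpow_mem (mem_henselizedAdjoin_self V K x') M), ?_⟩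
    rw [h, map_mul, map_zpow₀]
  have hrF'' : IsRankOneValued V (henselizedAdjoin V K x') :=
    hr.of_le_of_isValueTranscendentalOver hF''E hx' (mem_henselizedAdjoin_self V K x')
  ---------------------------------------------------------------- Step 8: the italicized statement
  have hEeq' : E = henselizedAdjoin V K x' := hM Ω V K hK x' hx' hrF'' E hF''E halgF'' himm
  exact ⟨x', hx'E, hx', hEeq'⟩

end Lemma55

/-! ### (R4), value-transcendental case, with Lemma 5.5 discharged -/

/-- **Kuhlmann 2010, (R4) for `F = K(t)` of rank one with a value-transcendental generator over
an algebraically closed `K`**, from Thm. 2.14, "the henselization is henselian", "the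
henselization is immediate" (Lemma 2.2), the Lemma of Ostrowski and the italicized statement
of §5 — `Kuhlmann2010StabilityRankOneValueTranscendental.of_facts` with Lemma 5.5 supplied by
`Kuhlmann2010Lemma55ValueTranscendental.of_immediateExt`.
[cite: Kuhlmann2010, Section 5, Lemma 5.4 (R4) and proof of (R4) (pp. 18–20)] -/
theorem Kuhlmann2010StabilityRankOneValueTranscendental.of_facts'
    (hT : Kuhlmann2010DefectlessIffHenselization.{u})
    (hH : Kuhlmann2010HenselizationIsHenselian.{u})
    (hI : Kuhlmann2010HenselizationImmediate.{u}) (hO : Kuhlmann2010OstrowskiLemma.{u})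
    (hM : Kuhlmann2010HenselizedRationalImmediateExt.{u}) :
    Kuhlmann2010StabilityRankOneValueTranscendental.{u} :=
  Kuhlmann2010StabilityRankOneValueTranscendental.of_facts hT hH hO hM
    (Kuhlmann2010Lemma55ValueTranscendental.of_immediateExt hH hI hM)

end Literature.AlgebraicGeometry.Resolution
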